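import Mathlib
import Summits.PneNP.PneNP.Theses.SymmetryBudget
import Literature.Computability.Complexity.SymmetricCircuit
import Literature.Computability.Complexity.GraphCanonization

/-!
# Sketch — crux `NoHiddenOrder` (stmt-PneNP-14781), ideator k = 2, round 1

First-lemma signatures for the two crux idea cards

* `kelly-ulam-deck-interface`  — `ReconstructionConjecture`, `noHiddenOrder_of_reconstruction`,
  `not_reconstruction_of_windowBarrier` (contrapositive barrier for the sibling crux `WindowBarrier`);
* `muller-mark-reconstruction` — `muller_structure` (Müller's theorem for structures, Lauri–Scapellato
  Thm 11.8: the interface lemma of the marked-subset DP), provable now.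

Only statements are claimed to elaborate; proofs are `sorry` except the pure-logic iff.
-/

namespace Summit.PneNP.PneNP.Cruxes.NoHiddenOrder.SketchK2

open scoped Classical
open Filter Literature.Computability.Complexity Summit.PneNP.PneNP.Theses.SymmetryBudget

/-! ## The dichotomy is one item: `NoHiddenOrder ↔ ¬ WindowBarrier` (pure logic) -/

theorem noHiddenOrder_iff_not_windowBarrier : NoHiddenOrder ↔ ¬ WindowBarrier := by
  simp only [NoHiddenOrder, WindowBarrier]
  push Not
  rfl

/-! ## Card A: Kelly–Ulam reconstruction as the interface lemma of subset-DP canonisation -/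

/-- `G` and `H` are *hypomorphic*: some bijection matches their vertex-deleted subgraphs up to
isomorphism (equivalently, equal decks). -/
def Hypomorphic {k : ℕ} (G H : SimpleGraph (Fin k)) : Prop :=
  ∃ φ : Fin k ≃ Fin k, ∀ v : Fin k,
    Nonempty (G.induce {w : Fin k | w ≠ v} ≃g H.induce {w : Fin k | w ≠ φ v})

/-- **The Reconstruction Conjecture** (Kelly 1942 / Ulam 1960; Lauri–Scapellato ch. 8): finite simple
graphs on at least three vertices with equal decks are isomorphic. A CONJECTURE — if used by a line it
is a route item / conditional, never a Literature fact. -/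
def ReconstructionConjecture : Prop :=
  ∀ k : ℕ, 3 ≤ k → ∀ G H : SimpleGraph (Fin k), Hypomorphic G H → Nonempty (G ≃g H)

/-- **Card A, first lemma (the line's conclusion, by name).** Kelly–Ulam + a `2^{O(k)}`-time canonical
form (Babai–Luks 1983, tree named fact) give poly-size `Bud(m,⌊log₂ m⌋)`-symmetric threshold circuits
for every `P`-language with invariant slices: deck-DP over the `2^{3g+1}` subsets of (free part + tag
clique), interface `F_k` = "reconstruct from the sorted deck of canonical cards" (unique by RC,
`2^{O(k)}`-size by BL83), then canonise-then-compute (`SymCanonisation ⇒ ¬WindowBarrier`, disprover F12). -/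
theorem noHiddenOrder_of_reconstruction
    (hRC : ReconstructionConjecture) (hBL : babaiLuks1983_canonicalForm) : NoHiddenOrder := by
  sorry

/-- **Contrapositive = a barrier for the sibling crux.** Any proof of `WindowBarrier` refutes the
Reconstruction Conjecture (given BL83). -/
theorem not_reconstruction_of_windowBarrier (hBL : babaiLuks1983_canonicalForm)
    (hWB : WindowBarrier) : ¬ ReconstructionConjecture := fun hRC =>
  (noHiddenOrder_iff_not_windowBarrier.1 (noHiddenOrder_of_reconstruction hRC hBL)) hWB

/-! ## Card B: reconstruct the MARKS, not the graph — Müller's theorem for structures -/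

/-- **Müller's theorem for structures** (Lovász 1972 / Müller 1977 / Nash-Williams' lemma;
Lauri–Scapellato, *Topics in Graph Automorphisms and Reconstruction*, Thm 11.8): for a permutation
group `Γ` on `D` and `E ⊆ D` with `2^{|E|-1} > |Γ|`, the `Γ`-orbit of `E` is determined by the deck of
`Γ`-orbits of the sets `E − x`, `x ∈ E`. Here: `D` = (free vertices of `T`) × (mark labels),
`Γ = Aut(H[T], c)` acting diagonally, `E` = the marks. Provable now (inclusion–exclusion + counting). -/
theorem muller_structure {D : Type*} [Fintype D] [DecidableEq D]
    (Γ : Subgroup (Equiv.Perm D)) [Fintype Γ] (E E' : Finset D)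
    (hΓ : Fintype.card Γ < 2 ^ (E.card - 1))
    (hdeck : ∃ φ : E ≃ E', ∀ x : E, ∃ γ : Γ,
      (E.erase (x : D)).image (fun d => (γ : Equiv.Perm D) d) = E'.erase (φ x : D)) :
    ∃ γ : Γ, E.image (fun d => (γ : Equiv.Perm D) d) = E' := by
  sorry

/-- The **k-deletion form** (Alon–Caro–Krasikov–Roditty 1989; Lauri–Scapellato Thm 11.9):
`2^{|E|-k} > |Γ|` ⇒ `E` is determined up to `Γ` by the `Γ`-orbits of its `(|E|-k)`-subsets. Stated for
the record (the DP only needs `k = 1`). -/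
theorem ackr_structure {D : Type*} [Fintype D] [DecidableEq D]
    (Γ : Subgroup (Equiv.Perm D)) [Fintype Γ] (k : ℕ) (E E' : Finset D) (hEE' : E.card = E'.card)
    (hΓ : Fintype.card Γ < 2 ^ (E.card - k))
    (hdeck : ∃ φ : {A : Finset D // A ⊆ E ∧ A.card + k = E.card} ≃ {A : Finset D // A ⊆ E' ∧ A.card + k = E'.card},
      ∀ A : {A : Finset D // A ⊆ E ∧ A.card + k = E.card},
        ∃ γ : Γ, A.1.image (fun d => (γ : Equiv.Perm D) d) = (φ A).1) :
    ∃ γ : Γ, E.image (fun d => (γ : Equiv.Perm D) d) = E' := by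
  sorry

end Summit.PneNP.PneNP.Cruxes.NoHiddenOrder.SketchK2
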